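import Summits.PneNP.PneNP.Theorems.SymmetryBudgetNoHiddenOrderBitValuation

/-!
# `NoHiddenOrder` (stmt-PneNP-14781), (R2c) value layer I: the bit valuation — the covering classes of the pasted layout

Route `PneNP/SymmetryBudget`; continues `SymmetryBudgetNoHiddenOrderBitValuation.lean`.  At a section node the parts
(switching components) partition the block (`sum_card_parts`) and two distinct parts have uniform cross data
(`adj_iff_swComp_of_ne`).  Laying the parts out class by class in increasing value order — a part `J` starts its class at row
`ltCnt J` and the class occupies `mult J · |J|` rows — every row of the block is COVERED by the class of some part
(`exists_covers`) and covering classes are unique (`f_eq_of_covers`).  Hypotheses are bundled as section variables: `hs` (the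
node is a section node), `PartEnums` (the parts' values are their encodings), `hI` (well formed).  Sorry-free; supports
stmt-PneNP-14781.
-/

set_option linter.dupNamespace false -- `Summit.PneNP.PneNP.…` (D-0017 single-conjunct layout)

namespace Summit.PneNP.PneNP.Theorems

open Finset BranchSum

namespace CGBits

variable {V : Type*} [DecidableEq V] {G : SimpleGraph V} [DecidableRel G.Adj] {n : ℕ}

/-! ### Pasting: the parts of a section node -/

section Paste

variable {I : CGInst V} (hs : cgStep G I = .andNode (cgParts G I))
include hs

/-- Distinct parts have disjoint blocks. [folklore] -/
theorem parts_disjoint {J J' : CGInst V} (hJ : J ∈ cgParts G I) (hJ' : J' ∈ cgParts G I) (hne : J ≠ J') :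
    Disjoint J.1.1 J'.1.1 :=
  cgStep_parts_disjoint (G := G) I (cgParts G I) hs J hJ J' hJ' hne

omit hs in
/-- Every vertex of the block lies in a part. [folklore] -/
theorem exists_part_of_mem {u : V} (hu : u ∈ I.1.1) : ∃ J ∈ cgParts G I, u ∈ J.1.1 :=
  ⟨⟨(swReach G I.1.1 I.1.2 u, I.1.2), ⟨u, self_mem_swReach _ hu⟩⟩,
    mem_cgParts_iff.2 ⟨rfl, mem_image_of_mem _ hu⟩, self_mem_swReach _ hu⟩

omit hs in
/-- Parts lie inside the block. [folklore] -/
theorem part_subset {J : CGInst V} (hJ : J ∈ cgParts G I) : J.1.1 ⊆ I.1.1 := by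
  obtain ⟨-, hK⟩ := mem_cgParts_iff.1 hJ
  obtain ⟨w, -, hw⟩ := mem_image.1 hK
  exact hw ▸ swReach_subset _ _ w

/-- **The parts partition the block**: their sizes add up to the block size. [folklore] -/
theorem sum_card_parts : ∑ J ∈ cgParts G I, J.1.1.card = I.1.1.card := by
  rw [← card_biUnion fun J hJ J' hJ' hne => parts_disjoint hs hJ hJ' hne]
  congr 1
  ext u
  rw [mem_biUnion]
  exact ⟨fun ⟨J, hJ, hu⟩ => part_subset hJ hu, fun hu => exists_part_of_mem hu⟩

omit hs in
/-- **Cross data between two distinct parts is uniform**: adjacency is the colour-level switching datum. [folklore] -/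
theorem adj_iff_swComp_of_ne {J J' : CGInst V} (hJ : J ∈ cgParts G I) (hJ' : J' ∈ cgParts G I) (hne : J ≠ J')
    {u w : V} (hu : u ∈ J.1.1) (hw : w ∈ J'.1.1) : G.Adj u w ↔ SwComp G I.1.1 I.1.2 u w := by
  obtain ⟨hc, hK⟩ := mem_cgParts_iff.1 hJ
  obtain ⟨hc', hK'⟩ := mem_cgParts_iff.1 hJ'
  obtain ⟨a, ha, hKa⟩ := mem_image.1 hK
  obtain ⟨b, hb, hKb⟩ := mem_image.1 hK'
  have hu' : u ∈ swReach G I.1.1 I.1.2 a := hKa ▸ hu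
  have hw' : w ∈ swReach G I.1.1 I.1.2 b := hKb ▸ hw
  have hblocks : J.1.1 ≠ J'.1.1 := fun h => hne (Subtype.ext (Prod.ext h (hc.trans hc'.symm)))
  have huw : u ≠ w := by
    rintro rfl
    exact hblocks (hKa.symm.trans (((swReach_eq_of_mem _ ha hu').symm.trans (swReach_eq_of_mem _ hb hw')).trans hKb))
  have hnadj : ¬ (swGraph G I.1.1 I.1.2).Adj u w := fun hadj => by
    have hw'' : w ∈ swReach G I.1.1 I.1.2 a := swReach_closed _ a hu' (swReach_subset _ _ b hw') hadj
    exact hblocks (hKa.symm.trans (((swReach_eq_of_mem _ ha hw'').symm.trans (swReach_eq_of_mem _ hb hw')).trans hKb))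
  rw [swGraph_adj] at hnadj
  tauto

variable {f : CGInst V → BVal n}

omit hs in
/-- `ltCnt` depends on the value only. [folklore] -/
theorem ltCnt_congr {J J' : CGInst V} (h : f J = f J') : ltCnt G n I f J = ltCnt G n I f J' := by
  unfold ltCnt; rw [h]

omit hs in
/-- `mult` depends on the value only. [folklore] -/
theorem mult_congr {J J' : CGInst V} (h : f J = f J') : mult G n I f J = mult G n I f J' := by
  unfold mult; rw [h]

omit hs in
/-- A part has positive multiplicity. [folklore] -/
theorem mult_pos {J : CGInst V} (hJ : J ∈ cgParts G I) : 0 < mult G n I f J :=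
  card_pos.2 ⟨J, mem_filter.2 ⟨hJ, rfl⟩⟩

variable (G n) in
/-- Hypothesis bundle for the parts' values: each part's value is its encoding along an enumeration. -/
structure PartEnums (I : CGInst V) (f : CGInst V → BVal n) (eJ : CGInst V → Fin n → V) : Prop where
  /-- enumerations -/
  isEnum : ∀ J ∈ cgParts G I, IsEnum n J.1.1 (eJ J)
  /-- values are the encodings (in the common colouring) -/
  eq : ∀ J ∈ cgParts G I, f J = bitEnc G n I.1.2 J.1.1.card (eJ J)

variable {eJ : CGInst V → Fin n → V} (hP : PartEnums G n I f eJ) (hI : Wf n I)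
include hP hI

omit hs in
/-- The value of a part determines its size. [folklore] -/
theorem card_eq_nrows {J : CGInst V} (hJ : J ∈ cgParts G I) : J.1.1.card = nrows (f J) := by
  rw [hP.eq J hJ, nrows_bitEnc (hP.isEnum J hJ).card_le]
  intro i hi
  exact hI _ (part_subset hJ ((hP.isEnum J hJ).mem i hi))

omit hs in
/-- Parts of equal value have equal size. [folklore] -/
theorem card_eq_of_f_eq {J J' : CGInst V} (hJ : J ∈ cgParts G I) (hJ' : J' ∈ cgParts G I) (h : f J = f J') :
    J.1.1.card = J'.1.1.card := by
  rw [card_eq_nrows hP hI hJ, card_eq_nrows hP hI hJ', h]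

omit hs in
/-- The class of a part occupies `mult · size` rows. [folklore] -/
theorem sum_class_eq {J : CGInst V} (hJ : J ∈ cgParts G I) :
    ∑ J' ∈ (cgParts G I).filter (fun J' => f J' = f J), J'.1.1.card = mult G n I f J * J.1.1.card := by
  unfold mult
  rw [← smul_eq_mul, ← sum_const]
  exact sum_congr rfl fun J' hJ' => card_eq_of_f_eq hP hI (mem_filter.1 hJ').1 hJ (mem_filter.1 hJ').2

/-- The rows up to and including the class of `J` fit in the block. [folklore] -/
theorem ltCnt_add_le {J : CGInst V} (hJ : J ∈ cgParts G I) :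
    ltCnt G n I f J + mult G n I f J * J.1.1.card ≤ I.1.1.card := by
  classical
  rw [← sum_class_eq hP hI hJ, ltCnt, ← sum_union, ← sum_card_parts hs]
  · apply sum_le_sum_of_subset
    exact union_subset (filter_subset _ _) (filter_subset _ _)
  · rw [disjoint_filter]
    intro J' _ hlt heq
    rw [heq] at hlt
    exact lt_irrefl _ hlt

omit hs in
/-- A part of larger value starts after the whole class of a part of smaller value. [folklore] -/
theorem ltCnt_add_le_ltCnt {J J' : CGInst V} (hJ : J ∈ cgParts G I)
    (hlt : toLex (f J) < toLex (f J')) : ltCnt G n I f J + mult G n I f J * J.1.1.card ≤ ltCnt G n I f J' := by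
  classical
  rw [← sum_class_eq hP hI hJ, ltCnt, ltCnt, ← sum_union]
  · apply sum_le_sum_of_subset
    refine union_subset (fun K hK => ?_) (fun K hK => ?_)
    · exact mem_filter.2 ⟨(mem_filter.1 hK).1, (mem_filter.1 hK).2.trans hlt⟩
    · refine mem_filter.2 ⟨(mem_filter.1 hK).1, ?_⟩
      rw [(mem_filter.1 hK).2]
      exact hlt
  · rw [disjoint_filter]
    intro K _ hKlt hKeq
    rw [hKeq] at hKlt
    exact lt_irrefl _ hKlt

omit hP hI hs in
/-- Covering, unfolded as an interval condition. [folklore] -/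
theorem covers_iff {J : CGInst V} (i : ℕ) : Covers G n I f J i ↔
    J ∈ cgParts G I ∧ ltCnt G n I f J ≤ i ∧ i < ltCnt G n I f J + mult G n I f J * J.1.1.card := by
  unfold Covers
  refine and_congr_right fun hJ => and_congr_right fun hle => ?_
  rw [Nat.div_lt_iff_lt_mul (card_pos.2 J.2)]
  omega

/-- **Every row of the block is covered by the class of some part.** [folklore] -/
theorem exists_covers {i : ℕ} (hi : i < I.1.1.card) : ∃ J, Covers G n I f J i := by
  classical
  -- the parts starting at or before row `i`
  set T := (cgParts G I).filter fun J => ltCnt G n I f J ≤ i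
  have hne : (cgParts G I).Nonempty := by
    obtain ⟨u, hu⟩ := I.2
    obtain ⟨J, hJ, -⟩ := exists_part_of_mem (G := G) hu
    exact ⟨J, hJ⟩
  -- a part of least value starts at row 0
  obtain ⟨J₀, hJ₀, hmin⟩ := exists_min_image (cgParts G I) (fun J => toLex (f J)) hne
  have hT₀ : J₀ ∈ T := by
    refine mem_filter.2 ⟨hJ₀, ?_⟩
    have : ltCnt G n I f J₀ = 0 := by
      unfold ltCnt
      rw [sum_eq_zero]
      intro K hK
      exact absurd (mem_filter.1 hK).2 (not_lt.2 (hmin K (mem_filter.1 hK).1))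
    omega
  -- a part in `T` of largest value covers `i`
  obtain ⟨J, hJT, hmax⟩ := exists_max_image T (fun J => toLex (f J)) ⟨J₀, hT₀⟩
  obtain ⟨hJ, hJi⟩ := mem_filter.1 hJT
  refine ⟨J, (covers_iff i).2 ⟨hJ, hJi, ?_⟩⟩
  by_contra hge
  replace hge : ltCnt G n I f J + mult G n I f J * J.1.1.card ≤ i := not_lt.1 hge
  -- then all parts of value `≤ f J` occupy at most `i` rows; a part of the next value would lie in `T`
  by_cases hall : ∃ K ∈ cgParts G I, toLex (f J) < toLex (f K)
  · obtain ⟨J₁, hJ₁, hmin₁⟩ := exists_min_image ((cgParts G I).filter fun K => toLex (f J) < toLex (f K))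
      (fun J => toLex (f J)) (by obtain ⟨K, hK, hlt⟩ := hall; exact ⟨K, mem_filter.2 ⟨hK, hlt⟩⟩)
    obtain ⟨hJ₁p, hJJ₁⟩ := mem_filter.1 hJ₁
    have hlt₁ : ltCnt G n I f J₁ ≤ ltCnt G n I f J + mult G n I f J * J.1.1.card := by
      rw [← sum_class_eq hP hI hJ, ltCnt, ltCnt, ← sum_union]
      · apply sum_le_sum_of_subset
        intro K hK
        obtain ⟨hKp, hKlt⟩ := mem_filter.1 hK
        rcases lt_trichotomy (toLex (f K)) (toLex (f J)) with h | h | h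
        · exact mem_union_left _ (mem_filter.2 ⟨hKp, h⟩)
        · exact mem_union_right _ (mem_filter.2 ⟨hKp, toLex_inj.1 h⟩)
        · exact absurd hKlt (not_lt.2 (hmin₁ K (mem_filter.2 ⟨hKp, h⟩)))
      · rw [disjoint_filter]
        intro K _ hKlt hKeq
        rw [hKeq] at hKlt
        exact lt_irrefl _ hKlt
    have hJ₁T : J₁ ∈ T := mem_filter.2 ⟨hJ₁p, hlt₁.trans hge⟩
    exact absurd (hmax J₁ hJ₁T) (not_le.2 hJJ₁)
  · have hall' : ∀ K ∈ cgParts G I, toLex (f K) ≤ toLex (f J) := fun K hK => not_lt.1 fun h => hall ⟨K, hK, h⟩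
    have hsum : I.1.1.card ≤ ltCnt G n I f J + mult G n I f J * J.1.1.card := by
      rw [← sum_class_eq hP hI hJ, ltCnt, ← sum_union, ← sum_card_parts hs]
      · apply sum_le_sum_of_subset
        intro K hK
        rcases (hall' K hK).lt_or_eq with h | h
        · exact mem_union_left _ (mem_filter.2 ⟨hK, h⟩)
        · exact mem_union_right _ (mem_filter.2 ⟨hK, toLex_inj.1 h⟩)
      · rw [disjoint_filter]
        intro K _ hKlt hKeq
        rw [hKeq] at hKlt
        exact lt_irrefl _ hKlt
    omega

omit hs in
/-- **Covering classes are unique**: two parts covering the same row have the same value. [folklore] -/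
theorem f_eq_of_covers {J J' : CGInst V} {i : ℕ} (hJ : Covers G n I f J i) (hJ' : Covers G n I f J' i) : f J = f J' := by
  obtain ⟨hJp, hJle, hJlt⟩ := (covers_iff i).1 hJ
  obtain ⟨hJ'p, hJ'le, hJ'lt⟩ := (covers_iff i).1 hJ'
  rcases lt_trichotomy (toLex (f J)) (toLex (f J')) with h | h | h
  · have := ltCnt_add_le_ltCnt hP hI hJp h; omega
  · exact toLex_inj.1 h
  · have := ltCnt_add_le_ltCnt hP hI hJ'p h; omega

end Paste

end CGBits

end Summit.PneNP.PneNP.Theorems
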